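import Literature.AlgebraicGeometry.Resolution.Temkin2013CurveSmoothingProofs
import HarnessLib

/-!
# Temkin's Thm. 3.3.1 (smooth-fibre case): the purely inseparable level reduction

Topic: `Literature/AlgebraicGeometry/Resolution`. M. Temkin, *Inseparable local uniformization*,
J. Algebra 373 (2013) 65–119 = arXiv:0804.1554v3, Thm. 3.3.1 (tree: the named fact
`Temkin2013RelativeCurveSmoothFibre`, `InseparableLocalUniformizationCurvesStepOne.lean`). Its
printed proof extends the ground valued field `k` twice by finite purely inseparable
extensions: in Step 1 ("The `k`-curve `C̄_η` can be made smooth by finite purely inseparable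
extension of the basic field and subsequent normalization … We claim that it suffices to prove
the Theorem for `F`, `C_F = Nr_{FK}(C)` and `FKᵢ`'s instead of `k`, `C` and `Kᵢ`'s … So, we can
extend the ground valued field `k` to `F`") and in Step 2, where the valuation-theoretic input
(Thm. 3.2.6) comes with "a finite purely inseparable extension `l/k`" of its own. In the
algebraic proof assembled in the tree the second extension is handled by the mechanism of the
first: one passes to a finite purely inseparable LEVEL `l ⊇ l_val` of the perfect closure of `k`
inside the ambient algebraically closed valued field `(Ω, V) ⊇ (K₁, K₁°)` containing the
constants `l_val` demanded by the valuative input, deep enough for the normalized generic fibres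
to stay smooth (Görtz–Wedhorn II, Lemma 26.43 (1), in the tree's effective form
`CurveSmoothing.exists_level_smooth`), re-establishes ALL the hypotheses of the fact for the level
data `(l, lK, lK₁)` (as in `Temkin2013RelativeCurve.of_smoothGenericFibre`), with the valuation
rings INDUCED BY `V` (so that the valuative input, read inside the same `(Ω, V)`, now has a
trivial purely inseparable part), and descends the conclusion by Step 1
(`Temkin2013RelativeCurveConclusion.of_purelyInseparable`). This file PROVES that reduction as
one statement:

* `exists_smoothFibre_level` — given the data and hypotheses of `Temkin2013RelativeCurveSmoothFibre`
  (except its two smoothness hypotheses, which are not needed: smoothness is re-derived at deep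
  levels), an algebraically closed valued field `(Ω, V)` over `K₁` inducing `K₁°`, and a finite
  set `S` of elements of the perfect closure of `k` in `Ω`: a finite purely inseparable level
  `lvl ⊇ S` of `Ω/k` and the level data — the fields `F = K·lvl ≤ F₁ = K₁·lvl ≤ Ω` (intermediate
  fields of `Ω/k`, algebras over `K`, `K₁` compatibly with the embeddings into `Ω`), the copy
  `l₀ ≅ lvl` of the level inside `F`, the valuation rings `F₁° = V ∩ F₁ ⊇ F° ⊇ l₀°`, the affine
  normalized model `A_F = Nr_F(l₀°[s]) ⊇ A` — satisfying every hypothesis of the fact (equal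
  characteristic, heights one, finite generation, transcendence degree one, value-torsion,
  residual algebraicity, the model, finiteness of `F₁/F`, smoothness of BOTH normalized generic
  fibres over `l₀`), together with the implication "conclusion of Thm. 3.3.1 for the level data ⇒
  conclusion for the original data" — PROVED.

All statements are [folklore] glue over the cited results; no definitions, no named facts.

## Sources

* M. Temkin, arXiv:0804.1554v3, proof of Thm. 3.3.1, Step 1 (pp. 44–45) and Step 2 (p. 45:
  "we can choose `l̄` of the form `l̂` for a finite purely inseparable extension `l/k`").
  [Temkin2013]
* U. Görtz, T. Wedhorn, *Algebraic Geometry II* (2023), Lemma 26.43 (1), through the tree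
  (`CurveSmoothing.exists_level_smooth`, `Temkin2013CurveSmoothingProofs.lean`). [GortzWedhorn2023]
-/

noncomputable section

open IsLocalRing

namespace Literature.AlgebraicGeometry.Resolution

universe u

set_option maxHeartbeats 800000 in
set_option synthInstance.maxHeartbeats 80000 in
open CurveSmoothing in
/-- **The purely inseparable level reduction for the smooth-fibre case of Thm. 3.3.1.** See the
module docstring. Data: the data and hypotheses of `Temkin2013RelativeCurveSmoothFibre`; an
algebraically closed `Ω` over the tower `k → K → K₁` with a valuation ring `V` inducing `K₁°`;
a finite set `S` of elements of `Ω` purely inseparable over `k`. Conclusion: a finite purely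
inseparable level `lvl ∋ S` and level data `(l₀, F, F₁, l₀°, F°, F₁°, A_F)` inside `Ω`
satisfying all hypotheses of the fact, with `F₁° = V ∩ F₁`, and such that the conclusion of
Thm. 3.3.1 for the level data implies the conclusion for the original data.
[cite: Temkin2013, proof of Thm. 3.3.1, Steps 1–2] -/
theorem exists_smoothFibre_level (k K : Type u) [Field k] [Field K] [Algebra k K]
    (Ok : ValuationSubring k) (O : ValuationSubring K)
    (hchar : ringChar (ResidueField Ok) = ringChar k)
    (hOk : O.comap (algebraMap k K) = Ok) (hdimk : ringKrullDim Ok = 1)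
    (hdimK : ringKrullDim O = 1) (hfg : (⊤ : IntermediateField k K).FG)
    (htr : Algebra.trdeg k K = 1) (hvt : IsValueTorsionOver O (algebraMap k K).fieldRange ⊤)
    (hra : IsResiduallyAlgebraicOver O (algebraMap k K).fieldRange ⊤)
    (A : Subring K) (hA : IsAffineNormalizedModel O (Ok.toSubring.map (algebraMap k K)) A)
    (K₁ : Type u) [Field K₁] [Algebra K K₁] [Algebra k K₁] [IsScalarTower k K K₁]
    [FiniteDimensional K K₁] (O₁ : ValuationSubring K₁) (hO₁ : O₁.comap (algebraMap K K₁) = O)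
    (Ω : Type u) [Field Ω] [IsAlgClosed Ω] [Algebra K₁ Ω] [Algebra K Ω] [Algebra k Ω]
    [IsScalarTower K K₁ Ω] [IsScalarTower k K₁ Ω] [IsScalarTower k K Ω]
    (V : ValuationSubring Ω) (hV : V.comap (algebraMap K₁ Ω) = O₁)
    (S : Finset Ω) (hS : (↑S : Set Ω) ⊆ perfectClosure k Ω) :
    ∃ (lvl : IntermediateField k Ω), (↑S : Set Ω) ⊆ lvl ∧ lvl ≤ perfectClosure k Ω ∧
      FiniteDimensional k lvl ∧
    ∃ (FE FE₁ : IntermediateField k Ω),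
      FE = (IsScalarTower.toAlgHom k K Ω).fieldRange ⊔ lvl ∧
      FE₁ = (IsScalarTower.toAlgHom k K₁ Ω).fieldRange ⊔ lvl ∧
    ∃ (hle : FE ≤ FE₁) (_ : Algebra K FE) (_ : IsScalarTower k K FE) (_ : Algebra K₁ FE₁)
      (_ : IsScalarTower k K₁ FE₁) (_ : Algebra K FE₁) (_ : IsScalarTower K K₁ FE₁),
      (∀ z : K, ((algebraMap K FE z : FE) : Ω) = algebraMap K Ω z) ∧
      (∀ z : K₁, ((algebraMap K₁ FE₁ z : FE₁) : Ω) = algebraMap K₁ Ω z) ∧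
      (letI : Algebra FE FE₁ := (IntermediateField.inclusion hle).toRingHom.toAlgebra
       IsScalarTower K FE FE₁ ∧ FiniteDimensional FE FE₁) ∧
      FiniteDimensional K FE ∧ IsPurelyInseparable K FE ∧
      FiniteDimensional K₁ FE₁ ∧ IsPurelyInseparable K₁ FE₁ ∧
    ∃ (l₀ : IntermediateField k FE),
      (∀ x : FE, x ∈ l₀ ↔ (x : Ω) ∈ lvl) ∧ FiniteDimensional k l₀ ∧ IsPurelyInseparable k l₀ ∧
      Algebra.adjoin K (l₀ : Set FE) = ⊤ ∧
      (letI : Algebra FE FE₁ := (IntermediateField.inclusion hle).toRingHom.toAlgebra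
       Algebra.adjoin K₁ (Set.range (algebraMap l₀ FE₁)) = ⊤) ∧
    -- the valuation rings induced by `V` and the model
    ∃ (A_F : Subring FE), A.map (algebraMap K FE) ≤ A_F ∧
      (letI : Algebra FE FE₁ := (IntermediateField.inclusion hle).toRingHom.toAlgebra
       let O_F₁ : ValuationSubring FE₁ := V.comap (algebraMap FE₁ Ω)
       let O_F : ValuationSubring FE := O_F₁.comap (algebraMap FE FE₁)
       let Ol₀ : ValuationSubring l₀ := O_F.comap (algebraMap l₀ FE)
       O_F₁.comap (algebraMap K₁ FE₁) = O₁ ∧ O_F.comap (algebraMap K FE) = O ∧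
       O_F = V.comap (algebraMap FE Ω) ∧ Ol₀.comap (algebraMap k l₀) = Ok ∧
       -- the hypotheses of the fact for the level data
       ringChar (ResidueField Ol₀) = ringChar l₀ ∧ ringKrullDim Ol₀ = 1 ∧ ringKrullDim O_F = 1 ∧
       (⊤ : IntermediateField l₀ FE).FG ∧ Algebra.trdeg l₀ FE = 1 ∧
       IsValueTorsionOver O_F (algebraMap l₀ FE).fieldRange ⊤ ∧
       IsResiduallyAlgebraicOver O_F (algebraMap l₀ FE).fieldRange ⊤ ∧
       IsAffineNormalizedModel O_F (Ol₀.toSubring.map (algebraMap l₀ FE)) A_F ∧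
       Algebra.Smooth l₀ (Algebra.adjoin l₀ (A_F : Set FE)) ∧
       Algebra.Smooth l₀ (Algebra.adjoin l₀ (nrIn (A_F.map (algebraMap FE FE₁)) : Set FE₁)) ∧
       -- Step 1: the conclusion descends
       (Temkin2013RelativeCurveConclusion l₀ FE Ol₀ O_F A_F FE₁ O_F₁ →
          Temkin2013RelativeCurveConclusion k K Ok O A K₁ O₁)) := by
  classical
  ------------------------------------------------------------------
  -- ### the embeddings and the perfect closure
  ------------------------------------------------------------------
  let χ : K →ₐ[k] Ω := IsScalarTower.toAlgHom k K Ω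
  let χ₁ : K₁ →ₐ[k] Ω := IsScalarTower.toAlgHom k K₁ Ω
  have hχ : ∀ z : K, χ z = χ₁ (algebraMap K K₁ z) := fun z => IsScalarTower.algebraMap_apply K K₁ Ω z
  have hχinj : Function.Injective χ := (χ : K →+* Ω).injective
  have hχ₁inj : Function.Injective χ₁ := (χ₁ : K₁ →+* Ω).injective
  have hrange : χ.fieldRange ≤ χ₁.fieldRange := by
    rintro _ ⟨z, rfl⟩
    exact ⟨algebraMap K K₁ z, (hχ z).symm⟩
  let kp : IntermediateField k Ω := perfectClosure k Ω
  haveI : PerfectField kp := perfectClosure.perfectField k Ω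
  haveI : Algebra.IsAlgebraic k kp := IsPurelyInseparable.isAlgebraic k _
  ------------------------------------------------------------------
  -- ### the model `A = Nr_K(k°[s])` and the function-field data
  ------------------------------------------------------------------
  obtain ⟨s, hsO, hAeq, hAfr⟩ := id hA
  set R₀ : Subring K := Ok.toSubring.map (algebraMap k K) with hR₀def
  set C : Subring K := Subring.closure ((R₀ : Set K) ∪ ↑s) with hCdef
  have hAeq' : A = nrIn C := SetLike.coe_injective (hAeq.trans (coe_nrIn C).symm)
  have hR₀O : R₀ ≤ O.toSubring := by
    rintro _ ⟨c, hc, rfl⟩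
    have : c ∈ O.comap (algebraMap k K) := by rw [hOk]; exact hc
    exact this
  obtain ⟨hAO, hR₀A⟩ := hA.le_and_le hR₀O
  have hCadj : C ≤ (Algebra.adjoin k (s : Set K)).toSubring := by
    refine Subring.closure_le.mpr ?_
    rintro x (⟨c, -, rfl⟩ | hx)
    · exact Subalgebra.algebraMap_mem _ c
    · exact Algebra.subset_adjoin hx
  have hfrac : ∀ z : K, ∃ a b : K, IsIntegral (Algebra.adjoin k (s : Set K)) a ∧
      IsIntegral (Algebra.adjoin k (s : Set K)) b ∧ z = a / b := by
    intro z
    obtain ⟨a, ha, b, hb, rfl⟩ := hAfr z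
    letI : Algebra C (Algebra.adjoin k (s : Set K)) := (Subring.inclusion hCadj).toAlgebra
    haveI : IsScalarTower C (Algebra.adjoin k (s : Set K)) K :=
      IsScalarTower.of_algebraMap_eq fun _ => rfl
    rw [hAeq'] at ha hb
    exact ⟨a, b, (mem_nrIn_iff.mp ha).tower_top, (mem_nrIn_iff.mp hb).tower_top, rfl⟩
  obtain ⟨u, hus, hu⟩ := exists_transcendental_mem htr s hfrac
  have hut : Transcendental k (χ u) := fun h => hu ((isAlgebraic_algHom_iff χ hχinj).mp h)
  obtain ⟨genK, hK, halgK⟩ := image_data K χ hfg htr.le hu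
  have hfg₁ : (⊤ : IntermediateField k K₁).FG := by
    rw [IntermediateField.fg_top_iff] at hfg ⊢
    haveI := hfg
    exact Algebra.EssFiniteType.comp k K K₁
  have htr₁ : Algebra.trdeg k K₁ ≤ 1 := by
    rw [trdeg_eq_of_finite (K := K) K₁]
    exact htr.le
  have hu₁ : Transcendental k (algebraMap K K₁ u) := fun h =>
    hu ((isAlgebraic_algHom_iff (IsScalarTower.toAlgHom k K K₁) (algebraMap K K₁).injective).mp h)
  obtain ⟨genK₁, hK₁, halgK₁⟩ := image_data K₁ χ₁ hfg₁ htr₁ hu₁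
  rw [← hχ u] at hK₁ halgK₁
  let sΩ : Finset Ω := s.image χ
  have hts : χ u ∈ sΩ := Finset.mem_image_of_mem χ hus
  have hsK : (sΩ : Set Ω) ⊆ χ.fieldRange := by
    rw [Finset.coe_image]
    rintro _ ⟨z, -, rfl⟩
    exact ⟨z, rfl⟩
  have hsK₁ : (sΩ : Set Ω) ⊆ χ₁.fieldRange := hsK.trans hrange
  ------------------------------------------------------------------
  -- ### one deep finite level containing `S`
  ------------------------------------------------------------------
  obtain ⟨l₁, hl₁k, hl₁fin, hsm₁⟩ :=
    exists_level_smooth χ.fieldRange kp sΩ genK hts hsK hut hK halgK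
  obtain ⟨l₂, hl₂k, hl₂fin, hsm₂⟩ :=
    exists_level_smooth χ₁.fieldRange kp sΩ genK₁ hts hsK₁ hut hK₁ halgK₁
  haveI := hl₁fin
  haveI := hl₂fin
  let lS : IntermediateField k Ω := IntermediateField.adjoin k (S : Set Ω)
  have hlSk : lS ≤ kp := IntermediateField.adjoin_le_iff.mpr hS
  haveI hlSfin : FiniteDimensional k lS := by
    refine IntermediateField.finiteDimensional_adjoin fun x hx => ?_
    have hxk : x ∈ kp := hS hx
    exact (Algebra.IsAlgebraic.isAlgebraic (⟨x, hxk⟩ : kp)).isIntegral.map (IsScalarTower.toAlgHom k kp Ω)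
  let lvl : IntermediateField k Ω := (l₁ ⊔ l₂) ⊔ lS
  have hlvlk : lvl ≤ kp := sup_le (sup_le hl₁k hl₂k) hlSk
  haveI hl₁₂fin : FiniteDimensional k (l₁ ⊔ l₂ : IntermediateField k Ω) :=
    IntermediateField.finiteDimensional_sup l₁ l₂
  haveI hlvlfin : FiniteDimensional k lvl := IntermediateField.finiteDimensional_sup _ lS
  have hSlvl : (↑S : Set Ω) ⊆ lvl := fun x hx =>
    (le_sup_right : lS ≤ lvl) (IntermediateField.subset_adjoin k _ hx)
  have hS₀ := hsm₁ lvl (le_sup_left.trans le_sup_left) hlvlk hlvlfin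
  have hS₁ := hsm₂ lvl (le_sup_right.trans le_sup_left) hlvlk hlvlfin
  clear hsm₁ hsm₂
  ------------------------------------------------------------------
  -- ### the fields `F = K·lvl ≤ F₁ = K₁·lvl` inside `Ω`
  ------------------------------------------------------------------
  let FE : IntermediateField k Ω := χ.fieldRange ⊔ lvl
  let FE₁ : IntermediateField k Ω := χ₁.fieldRange ⊔ lvl
  have hFEle : FE ≤ FE₁ := sup_le_sup_right hrange lvl
  letI iKFE : Algebra K FE :=
    ((χ : K →+* Ω).codRestrict FE fun z => (le_sup_left : χ.fieldRange ≤ FE) ⟨z, rfl⟩).toAlgebra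
  have hψ : ∀ z : K, ((algebraMap K FE z : FE) : Ω) = χ z := fun _ => rfl
  haveI iTk : IsScalarTower k K FE := IsScalarTower.of_algebraMap_eq fun c => by
    apply Subtype.ext
    show algebraMap k Ω c = χ (algebraMap k K c)
    exact (χ.commutes c).symm
  letI iK₁FE₁ : Algebra K₁ FE₁ :=
    ((χ₁ : K₁ →+* Ω).codRestrict FE₁ fun z => (le_sup_left : χ₁.fieldRange ≤ FE₁) ⟨z, rfl⟩).toAlgebra
  have hψ₁ : ∀ z : K₁, ((algebraMap K₁ FE₁ z : FE₁) : Ω) = χ₁ z := fun _ => rfl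
  haveI iTk₁ : IsScalarTower k K₁ FE₁ := IsScalarTower.of_algebraMap_eq fun c => by
    apply Subtype.ext
    show algebraMap k Ω c = χ₁ (algebraMap k K₁ c)
    exact (χ₁.commutes c).symm
  letI iFF₁ : Algebra FE FE₁ := (IntermediateField.inclusion hFEle).toRingHom.toAlgebra
  letI iKFE₁ : Algebra K FE₁ := ((algebraMap K₁ FE₁).comp (algebraMap K K₁)).toAlgebra
  haveI iT₁ : IsScalarTower K K₁ FE₁ := IsScalarTower.of_algebraMap_eq fun _ => rfl
  haveI iT₂ : IsScalarTower K FE FE₁ := IsScalarTower.of_algebraMap_eq fun z => Subtype.ext (hχ z).symm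
  -- the level inside `F`
  let l₀ : IntermediateField k FE := lvl.comap FE.val
  have hl₀mem : ∀ x : FE, x ∈ l₀ ↔ (x : Ω) ∈ lvl := fun _ => Iff.rfl
  haveI iT₃ : IsScalarTower l₀ FE FE₁ := IsScalarTower.of_algebraMap_eq fun _ => rfl
  obtain ⟨hl₀fin, hl₀pi, hl₀range⟩ := comap_level lvl FE le_sup_right
  haveI hl₀fin' : FiniteDimensional k l₀ := hl₀fin hlvlfin
  haveI hl₀pi' : IsPurelyInseparable k l₀ := hl₀pi hlvlk
  obtain ⟨hFfin, hFpi, hFgen⟩ := level_package K χ lvl hlvlk hψ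
  obtain ⟨hF₁fin, hF₁pi, hF₁gen⟩ := level_package K₁ χ₁ lvl hlvlk hψ₁
  haveI := hFfin; haveI := hFpi; haveI := hF₁fin; haveI := hF₁pi
  have hl₀set : {x : FE | (x : Ω) ∈ lvl} = (l₀ : Set FE) := Set.ext fun x => (hl₀mem x).symm
  have hl₀range₁ : Set.range (algebraMap l₀ FE₁) = {x : FE₁ | (x : Ω) ∈ lvl} := by
    ext x
    constructor
    · rintro ⟨c, rfl⟩
      exact (hl₀mem _).mp c.2
    · intro hx
      exact ⟨⟨⟨(x : Ω), (le_sup_right : lvl ≤ FE) hx⟩, (hl₀mem _).mpr hx⟩, Subtype.ext rfl⟩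
  have hFgen' : Algebra.adjoin K (l₀ : Set FE) = ⊤ := by rw [← hl₀set]; exact hFgen
  have hF₁gen' : Algebra.adjoin K₁ (Set.range (algebraMap l₀ FE₁)) = ⊤ := by
    rw [hl₀range₁]; exact hF₁gen
  -- smoothness, transported to the packaged fields
  have hsmT := smooth_transport K χ s lvl FE l₀ rfl hψ hl₀range hS₀
  have hss : (s.image (algebraMap K K₁)).image χ₁ = sΩ := by
    rw [Finset.image_image]
    exact Finset.image_congr fun z _ => (hχ z).symm
  rw [← hss] at hS₁
  have hl₀range' : Set.range (fun c : l₀ => ((algebraMap l₀ FE₁ c : FE₁) : Ω)) = (lvl : Set Ω) :=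
    hl₀range
  have hsmT₁ := smooth_transport K₁ χ₁ (s.image (algebraMap K K₁)) lvl FE₁ l₀ rfl hψ₁ hl₀range' hS₁
  have himage : algebraMap K₁ FE₁ '' ((s.image (algebraMap K K₁) : Finset K₁) : Set K₁) =
      algebraMap K FE₁ '' (s : Set K) := by
    rw [Finset.coe_image, Set.image_image]
    rfl
  rw [himage] at hsmT₁
  haveI h10 : FiniteDimensional FE FE₁ := by
    haveI : FiniteDimensional K FE₁ := Module.Finite.trans K₁ FE₁
    exact Module.Finite.of_restrictScalars_finite K FE FE₁
  ------------------------------------------------------------------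
  -- ### the valuation rings induced by `V`
  ------------------------------------------------------------------
  set O_F₁ : ValuationSubring FE₁ := V.comap (algebraMap FE₁ Ω) with hO_F₁def
  set O_F : ValuationSubring FE := O_F₁.comap (algebraMap FE FE₁) with hO_Fdef
  set Ol₀ : ValuationSubring l₀ := O_F.comap (algebraMap l₀ FE) with hOl₀def
  have hO_F₁K₁ : O_F₁.comap (algebraMap K₁ FE₁) = O₁ := by
    rw [← hV, hO_F₁def, ValuationSubring.comap_comap]
    congr 1
  have hO_Feq : O_F = V.comap (algebraMap FE Ω) := by
    rw [hO_Fdef, hO_F₁def, ValuationSubring.comap_comap]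
    rfl
  have hO_FK : O_F.comap (algebraMap K FE) = O := by
    rw [hO_Fdef, ValuationSubring.comap_comap, ← IsScalarTower.algebraMap_eq K FE FE₁,
      IsScalarTower.algebraMap_eq K K₁ FE₁, ← ValuationSubring.comap_comap, hO_F₁K₁, hO₁]
  have hOk' : Ol₀.comap (algebraMap k l₀) = Ok := valuationSubring_comap_ground_eq hOk hO_FK rfl
  ------------------------------------------------------------------
  -- ### the hypotheses of Thm. 3.3.1 for the level data
  ------------------------------------------------------------------
  have h1 : ringChar (ResidueField Ol₀) = ringChar l₀ :=
    ringChar_residueField_eq_of_comap_eq Ol₀ hOk' hchar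
  have h3 : ringKrullDim Ol₀ = 1 := by
    rw [ringKrullDim_eq_comap_of_isPurelyInseparable (K := k) Ol₀, hOk', hdimk]
  have h4 : ringKrullDim O_F = 1 := by
    rw [ringKrullDim_eq_comap_of_isPurelyInseparable (K := K) O_F, hO_FK, hdimK]
  have h5 : (⊤ : IntermediateField l₀ FE).FG := by
    obtain ⟨t, ht⟩ := hfg
    refine ⟨t.image (algebraMap K FE), ?_⟩
    rw [Finset.coe_image, eq_top_iff]
    rintro x -
    have hx : x ∈ Algebra.adjoin K (l₀ : Set FE) := by rw [hFgen']; trivial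
    induction hx using Algebra.adjoin_induction with
    | mem y hy => exact (IntermediateField.adjoin l₀ _).algebraMap_mem ⟨y, hy⟩
    | algebraMap r =>
      have hr : r ∈ (⊤ : IntermediateField k K) := trivial
      rw [← ht] at hr
      have hr' : algebraMap K FE r ∈ (IntermediateField.adjoin k (t : Set K)).map
          (IsScalarTower.toAlgHom k K FE) := ⟨r, hr, rfl⟩
      rw [IntermediateField.adjoin_map] at hr'
      have hle : IntermediateField.adjoin k (IsScalarTower.toAlgHom k K FE '' (t : Set K)) ≤
          (IntermediateField.adjoin l₀ (algebraMap K FE '' (t : Set K))).restrictScalars k :=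
        IntermediateField.adjoin_le_iff.mpr (IntermediateField.subset_adjoin l₀ _)
      exact hle hr'
    | add y z _ _ hy hz => exact add_mem hy hz
    | mul y z _ _ hy hz => exact mul_mem hy hz
  have h6 : Algebra.trdeg l₀ FE = 1 := by
    haveI : FaithfulSMul k K := (faithfulSMul_iff_algebraMap_injective k K).mpr
      (algebraMap k K).injective
    haveI : FaithfulSMul K FE := (faithfulSMul_iff_algebraMap_injective K FE).mpr
      (algebraMap K FE).injective
    haveI : FaithfulSMul k l₀ := (faithfulSMul_iff_algebraMap_injective k l₀).mpr
      (algebraMap k l₀).injective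
    haveI : FaithfulSMul l₀ FE := (faithfulSMul_iff_algebraMap_injective l₀ FE).mpr
      (algebraMap l₀ FE).injective
    have e1 := trdeg_add_eq k K (A := FE)
    have e2 := trdeg_add_eq k l₀ (A := FE)
    rw [htr, trdeg_eq_zero (R := K) (A := FE), add_zero] at e1
    rw [trdeg_eq_zero (R := k) (A := l₀), zero_add, ← e1] at e2
    exact e2
  have h7 : IsValueTorsionOver O_F (algebraMap l₀ FE).fieldRange ⊤ :=
    isValueTorsionOver_ground_of_isPurelyInseparable (k := k) O_F (hO_FK.symm ▸ hvt)
  have h8 : IsResiduallyAlgebraicOver O_F (algebraMap l₀ FE).fieldRange ⊤ :=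
    isResiduallyAlgebraicOver_ground_of_isPurelyInseparable (k := k) O_F (hO_FK.symm ▸ hra)
  -- the model `A_F = Nr_F(l₀°[s])`
  set R₀' : Subring FE := Ol₀.toSubring.map (algebraMap l₀ FE) with hR₀'def
  set s' : Set FE := algebraMap K FE '' (s : Set K) with hs'def
  set C_F : Subring FE := Subring.closure ((R₀' : Set FE) ∪ s') with hC_Fdef
  set A_F : Subring FE := nrIn C_F with hA_Fdef
  have hkOl₀ : ∀ c ∈ Ok, algebraMap k l₀ c ∈ Ol₀ := fun c hc => by
    have : c ∈ Ol₀.comap (algebraMap k l₀) := by rw [hOk']; exact hc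
    exact this
  have hCC_F : C.map (algebraMap K FE) ≤ C_F := by
    rw [Subring.map_le_iff_le_comap]
    refine Subring.closure_le.mpr ?_
    rintro x (⟨c, hc, rfl⟩ | hx)
    · refine Subring.subset_closure (Or.inl ⟨algebraMap k l₀ c, hkOl₀ c hc, ?_⟩)
      rw [← IsScalarTower.algebraMap_apply, ← IsScalarTower.algebraMap_apply]
    · exact Subring.subset_closure (Or.inr ⟨x, hx, rfl⟩)
  have hAA_F : A.map (algebraMap K FE) ≤ A_F := by
    rw [hAeq']; exact (map_nrIn_le C _).trans (nrIn_mono hCC_F)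
  have hpos : ∀ n : ℕ, 0 < ringExpChar K ^ n := fun n => expChar_pow_pos K (ringExpChar K) n
  have h9 : IsAffineNormalizedModel O_F R₀' A_F := by
    refine ⟨s.image (algebraMap K FE), ?_, ?_, fun z => ?_⟩
    · rw [Finset.coe_image]
      rintro _ ⟨x, hx, rfl⟩
      show algebraMap K FE x ∈ O_F
      rw [← ValuationSubring.mem_comap, hO_FK]; exact hsO hx
    · rw [Finset.coe_image]; exact coe_nrIn C_F
    · obtain ⟨n, y, hy⟩ := IsPurelyInseparable.pow_mem K (ringExpChar K) z
      obtain ⟨a, ha, b, hb, hyab⟩ := hAfr y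
      by_cases hb0 : b = 0
      · have hz : z = 0 := by
          rw [hb0, div_zero] at hyab
          rw [hyab, map_zero, eq_comm] at hy
          exact pow_eq_zero_iff (hpos n).ne' |>.mp hy
        exact ⟨0, A_F.zero_mem, 1, A_F.one_mem, by rw [hz, zero_div]⟩
      have hb0' : algebraMap K FE b ≠ 0 := (map_ne_zero _).mpr hb0
      refine ⟨z * algebraMap K FE b, ?_, algebraMap K FE b, hAA_F ⟨b, hb, rfl⟩, ?_⟩
      · have hpow : (z * algebraMap K FE b) ^ ringExpChar K ^ n =
            algebraMap K FE (a * b ^ (ringExpChar K ^ n - 1)) := by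
          rw [mul_pow, ← hy, ← map_pow, ← map_mul, hyab]
          congr 1
          obtain ⟨m, hm⟩ : ∃ m, ringExpChar K ^ n = m + 1 :=
            ⟨_, (Nat.succ_pred_eq_of_pos (hpos n)).symm⟩
          rw [hm, Nat.add_sub_cancel, pow_succ', ← mul_assoc, div_mul_cancel₀ a hb0]
        have hmem : algebraMap K FE (a * b ^ (ringExpChar K ^ n - 1)) ∈ A_F :=
          hAA_F ⟨_, A.mul_mem ha (A.pow_mem hb _), rfl⟩
        have hint : IsIntegral A_F (z * algebraMap K FE b) :=
          IsIntegral.of_pow (hpos n)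
            (by rw [hpow]; exact isIntegral_algebraMap (x := (⟨_, hmem⟩ : A_F)))
        have := mem_nrIn_iff.mpr hint
        rwa [hA_Fdef, nrIn_nrIn] at this
      · exact (mul_div_cancel_right₀ z hb0').symm
  -- smoothness of the two generic fibres over `l₀`
  have hsmF : Algebra.Smooth l₀ (Algebra.adjoin l₀ (A_F : Set FE)) := by
    rw [hA_Fdef, hC_Fdef, hR₀'def,
      adjoin_nrIn_closure_eq Ol₀.toSubring (exists_div_eq_of_valuationSubring Ol₀) s']
    exact hsmT
  have hsmF₁ : Algebra.Smooth l₀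
      (Algebra.adjoin l₀ (nrIn (A_F.map (algebraMap FE FE₁)) : Set FE₁)) := by
    have e1 : nrIn (A_F.map (algebraMap FE FE₁)) = nrIn (Subring.closure
        (((Ol₀.toSubring.map (algebraMap l₀ FE₁) : Subring FE₁) : Set FE₁) ∪
          algebraMap K FE₁ '' (s : Set K))) := by
      rw [hA_Fdef, nrIn_map_nrIn C_F, hC_Fdef, RingHom.map_closure, Set.image_union, hR₀'def,
        hs'def, ← Subring.coe_map, Subring.map_map, ← IsScalarTower.algebraMap_eq l₀ FE FE₁,
        Set.image_image]
      congr 3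
      ext x
      exact ⟨fun ⟨y, hy, e⟩ => ⟨y, hy, by rw [← e, IsScalarTower.algebraMap_apply K FE FE₁]⟩,
        fun ⟨y, hy, e⟩ => ⟨y, hy, by rw [← e, IsScalarTower.algebraMap_apply K FE FE₁]⟩⟩
    rw [e1, adjoin_nrIn_closure_eq Ol₀.toSubring (exists_div_eq_of_valuationSubring Ol₀)]
    exact hsmT₁
  ------------------------------------------------------------------
  -- ### assemble
  ------------------------------------------------------------------
  refine ⟨lvl, hSlvl, hlvlk, hlvlfin, FE, FE₁, rfl, rfl, hFEle, iKFE, iTk, iK₁FE₁, iTk₁, iKFE₁,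
    iT₁, hψ, hψ₁, ⟨iT₂, h10⟩, hFfin, hFpi, hF₁fin, hF₁pi, l₀, hl₀mem, hl₀fin', hl₀pi', hFgen',
    hF₁gen', A_F, hAA_F, hO_F₁K₁, hO_FK, hO_Feq, hOk', h1, h3, h4, h5, h6, h7, h8, h9, hsmF,
    hsmF₁, fun hconc => ?_⟩
  exact Temkin2013RelativeCurveConclusion.of_purelyInseparable Ok O hOk A hA K₁ O₁ l₀ FE Ol₀ O_F
    hO_FK rfl A_F hAA_F FE₁ hF₁gen' O_F₁ hO_F₁K₁ hconc

end Literature.AlgebraicGeometry.Resolution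

end
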